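import Summits.ResolutionOfSingularities.ResolutionOfSingularities.Theorems.PurelyInseparableDim4ChartAtlasSNCJacobian
import HarnessLib

/-!
# Purely inseparable four-folds `z^p + F(x₁, …, x₄)`: the Jacobian engine for an INDEXED family of equations (owners and ranks per index,
# no shape matching) with the centre presented by any finite set of indices (S3-N2 support; cell `res-dim4-pi`, typ-2 g6)

[OURS · counted 0] (D-0157 DOOR 2; DR-157-C). p701374 / p705578 take the equations as a finite set of POLYNOMIALS, so their users (p701847, p702981,
p706678) must recognise the shape of a polynomial to evaluate its owner — a dozen «`Qᵢ` is not a hyperplane» lemmas per chart. This file PROVES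
the same criterion for a family `f : ι₀ → K[y]` INDEXED by any type, owners `v 𝔭 a` and ranks `ρ 𝔭 a` being functions of the INDEX (no `sorry`,
no new axiom, every `n`, every field `K`):

* **`hasSNCWith_shf_of_jacobian_indexed`** — `E` a list of sheaves each `⊤` or `(f a)·𝒪` with `a ∈ I`; centre `V(f(G))` for a finite set of
  indices `G`; at a prime `𝔭` the FAMILY is `{a ∈ I : f a ∈ 𝔭} ∪ (G if f(G) ⊆ 𝔭)`; if `∂(f a)/∂y_{v a} ∉ 𝔭` on the family and
  `∂(f a)/∂y_{v a'} ∈ 𝔭` for `a ≠ a'` in the family with `ρ a ≤ ρ a'`, then `HasSNCWith E (shf (span f(G)))` (coincidences `f a = f a'` inside a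
  family need no separate treatment: they would contradict the two conditions);
* `hasSNCWith_𝓘Λ_of_jacobian_indexed` — the same for the coordinate centre `𝓘Λ n K Λ` when `span f(G) = (yᵢ : i ∈ Λ)`.

Nothing here is a statement about resolution of singularities in dimension ≥ 4 / characteristic `p` (NOT proved anywhere in this programme).
bears_on: LADDER-RESOLUTION:D157-DOOR2 (res-dim4-pi). Supports stmt-ResolutionOfSingularities-16155 (helper, S3-N2 engine).
-/

-- every declaration of this summit lives under `Summit.ResolutionOfSingularities.ResolutionOfSingularities`
-- (summit = problem), which the duplicate-namespace linter flags; house convention (cf. the Target file).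
set_option linter.dupNamespace false

noncomputable section

open MvPolynomial CategoryTheory AlgebraicGeometry Opposite TopologicalSpace IsLocalRing
open AlgebraicGeometry.Scheme.IdealSheafData (ofIdealTop)

namespace Summit.ResolutionOfSingularities.ResolutionOfSingularities.Theorems.PIDim4

open Literature.AlgebraicGeometry.Resolution
open Literature.AlgebraicGeometry.Resolution.AffinePointBlowup (P A γ coord Wtop ξ)
open Literature.AlgebraicGeometry.Hironaka2017.SpecOrders
open Literature.AlgebraicGeometry.Hironaka2017.Lib

namespace ChartDictionary

variable {n : ℕ} {K : Type} [Field K] {ι₀ : Type}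

/-- **SIMPLE NORMAL CROSSINGS FROM A POINTWISE TRIANGULAR JACOBIAN — INDEXED FAMILY.** `f : ι₀ → K[y₀, …, y_n]`; `E` a list of ideal sheaves on
`𝔸ⁿ⁺¹` each `⊤` or `(f a)·𝒪` for some `a ∈ I`; the centre is `V(f a : a ∈ G)`. At a prime `𝔭` the FAMILY consists of the `a ∈ I` with `f a ∈ 𝔭` and,
when `f a ∈ 𝔭` for all `a ∈ G`, of the members of `G`. If owners `v 𝔭 a` and ranks `ρ 𝔭 a` satisfy `∂(f a)/∂y_{v a} ∉ 𝔭` on the family and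
`∂(f a)/∂y_{v a'} ∈ 𝔭` for distinct `a, a'` of the family with `ρ a ≤ ρ a'`, then `HasSNCWith E (shf (span (f '' G)))`. -/
theorem hasSNCWith_shf_of_jacobian_indexed (E : List (P n K).IdealSheafData) (I G : Finset ι₀) (f : ι₀ → A n K)
    (hE : ∀ D ∈ E, D = ⊤ ∨ ∃ a ∈ I, D = ofIdealTop (Ideal.span {(γ n K).symm (f a)}))
    (ρ : P n K → ι₀ → ℕ) (v : P n K → ι₀ → Fin (n + 1))
    (hdiag : ∀ (x : P n K) (a : ι₀),
      (a ∈ I ∧ f a ∈ x.asIdeal ∨ a ∈ G ∧ ∀ g ∈ G, f g ∈ x.asIdeal) → pderiv (v x a) (f a) ∉ x.asIdeal)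
    (htri : ∀ (x : P n K) (a a' : ι₀),
      (a ∈ I ∧ f a ∈ x.asIdeal ∨ a ∈ G ∧ ∀ g ∈ G, f g ∈ x.asIdeal) →
      (a' ∈ I ∧ f a' ∈ x.asIdeal ∨ a' ∈ G ∧ ∀ g ∈ G, f g ∈ x.asIdeal) →
        a ≠ a' → ρ x a ≤ ρ x a' → pderiv (v x a') (f a) ∈ x.asIdeal) :
    HasSNCWith E (shf (A n K) (Ideal.span (f '' (G : Set ι₀)))) := by
  classical
  refine hasSNCWith_of_isRsopPart_labels E _ fun x => ?_
  -- the family at `x`, as a finite set of indices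
  let fam : Finset ι₀ := I.filter (fun a => f a ∈ x.asIdeal) ∪ (if ∀ g ∈ G, f g ∈ x.asIdeal then G else ∅)
  have hfam : ∀ a, a ∈ fam ↔ (a ∈ I ∧ f a ∈ x.asIdeal ∨ a ∈ G ∧ ∀ g ∈ G, f g ∈ x.asIdeal) := by
    intro a
    rw [Finset.mem_union, Finset.mem_filter]
    refine or_congr Iff.rfl ?_
    by_cases hG : ∀ g ∈ G, f g ∈ x.asIdeal
    · rw [if_pos hG]; exact ⟨fun h => ⟨h, hG⟩, fun h => h.1⟩
    · rw [if_neg hG]; exact ⟨fun h => absurd h (Finset.notMem_empty a), fun h => absurd h.2 hG⟩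
  have hfam𝔭 : ∀ a ∈ fam, f a ∈ x.asIdeal := by
    intro a ha
    rcases (hfam a).mp ha with ⟨-, h⟩ | ⟨ha, h⟩
    · exact h
    · exact h a ha
  -- enumerate it
  set r := fam.card with hr
  let e : fam ≃ Fin r := fam.equivFin
  let F : Fin r → A n K := fun c => f ((e.symm c : fam) : ι₀)
  have hFe : ∀ a : fam, F (e a) = f a := fun a => by simp only [F, Equiv.symm_apply_apply]
  -- the Jacobian minor and the part of a regular system of parameters
  have hdet : (Matrix.of fun c c' => pderiv (v x (e.symm c : fam)) (F c')).det ∉ x.asIdeal :=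
    det_not_mem_of_rank x.asIdeal _ (fun c => ρ x (e.symm c : fam)) (fun c => hdiag x _ ((hfam _).mp (e.symm c).2))
      (fun c c' hcc hρ => htri x _ _ ((hfam _).mp (e.symm c').2) ((hfam _).mp (e.symm c).2)
        (fun h => hcc (e.symm.injective (Subtype.ext h)).symm) hρ)
  have hz : IsRsopPart fun c => algebraMap (A n K) ((P n K).presheaf.stalk x) (F c) :=
    isRsopPart_algebraMap_of_det_not_mem x F (fun c => hfam𝔭 _ (e.symm c).2) (fun c => v x (e.symm c : fam)) hdet
  -- the index of a member of `E` through `x`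
  have hEq : ∀ D : {D : (P n K).IdealSheafData // D ∈ E ∧ x ∈ D.support},
      ∃ a : fam, D.1 = ofIdealTop (Ideal.span {(γ n K).symm (f a)}) := by
    intro D
    rcases hE D.1 D.2.1 with hD | ⟨a, haI, hD⟩
    · exfalso
      have h := D.2.2
      rw [hD, Scheme.IdealSheafData.support_top] at h
      exact h
    · have ha𝔭 : f a ∈ x.asIdeal := by
        have h := D.2.2
        rw [hD, mem_support_ofIdealTop_span_γ_symm_iff] at h
        exact h
      exact ⟨⟨a, (hfam a).mpr (Or.inl ⟨haI, ha𝔭⟩)⟩, hD⟩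
  choose af haf using hEq
  refine ⟨r, _, hz, ⟨fun D => e (af D), ?_, fun D => ?_⟩, fun hxC => ?_⟩
  · intro D₁ D₂ h12
    have h : af D₁ = af D₂ := e.injective h12
    apply Subtype.ext
    rw [haf D₁, haf D₂, h]
  · change stalkIdeal D.1 x = Ideal.span {algebraMap (A n K) ((P n K).presheaf.stalk x) (F (e (af D)))}
    rw [hFe, haf D, stalkIdeal_ofIdealTop_span_γ_symm]
  · -- the stalk of the centre is generated by the `f g`, `g ∈ G`, all in the family
    have hG : ∀ g ∈ G, f g ∈ x.asIdeal := by
      have h := (mem_support_shf_iff (A n K) _ x).mp hxC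
      exact fun g hg => h (Ideal.subset_span ⟨g, Finset.mem_coe.mpr hg, rfl⟩)
    have hGmem : ∀ g ∈ G, g ∈ fam := fun g hg => (hfam _).mpr (Or.inr ⟨hg, hG⟩)
    refine ⟨{c | ((e.symm c : fam) : ι₀) ∈ G}, ?_⟩
    rw [stalkIdeal_shf, Ideal.map_span]
    congr 1
    ext q
    constructor
    · rintro ⟨_, ⟨g, hg, rfl⟩, rfl⟩
      refine ⟨e ⟨g, hGmem g (Finset.mem_coe.mp hg)⟩, ?_, ?_⟩
      · change ((e.symm (e ⟨g, _⟩) : fam) : ι₀) ∈ G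
        rw [Equiv.symm_apply_apply]; exact Finset.mem_coe.mp hg
      · change algebraMap (A n K) ((P n K).presheaf.stalk x) (F (e ⟨g, _⟩)) = _
        rw [hFe]
    · rintro ⟨c, hc, rfl⟩
      exact ⟨f (e.symm c : fam), ⟨_, Finset.mem_coe.mpr hc, rfl⟩, rfl⟩

/-- **Indexed engine, coordinate centre**: if `span (f '' G) = (yᵢ : i ∈ Λ)` the same data give `HasSNCWith E (𝓘Λ n K Λ)`. -/
theorem hasSNCWith_𝓘Λ_of_jacobian_indexed (E : List (P n K).IdealSheafData) (Λ : Set (Fin (n + 1))) (I G : Finset ι₀) (f : ι₀ → A n K)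
    (hG : Ideal.span (f '' (G : Set ι₀)) = Ideal.span (X '' Λ))
    (hE : ∀ D ∈ E, D = ⊤ ∨ ∃ a ∈ I, D = ofIdealTop (Ideal.span {(γ n K).symm (f a)}))
    (ρ : P n K → ι₀ → ℕ) (v : P n K → ι₀ → Fin (n + 1))
    (hdiag : ∀ (x : P n K) (a : ι₀),
      (a ∈ I ∧ f a ∈ x.asIdeal ∨ a ∈ G ∧ ∀ g ∈ G, f g ∈ x.asIdeal) → pderiv (v x a) (f a) ∉ x.asIdeal)
    (htri : ∀ (x : P n K) (a a' : ι₀),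
      (a ∈ I ∧ f a ∈ x.asIdeal ∨ a ∈ G ∧ ∀ g ∈ G, f g ∈ x.asIdeal) →
      (a' ∈ I ∧ f a' ∈ x.asIdeal ∨ a' ∈ G ∧ ∀ g ∈ G, f g ∈ x.asIdeal) →
        a ≠ a' → ρ x a ≤ ρ x a' → pderiv (v x a') (f a) ∈ x.asIdeal) :
    HasSNCWith E (AffineCoordBlowup.𝓘Λ n K Λ) := by
  rw [𝓘Λ_eq_shf, ← hG]
  exact hasSNCWith_shf_of_jacobian_indexed E I G f hE ρ v hdiag htri

end ChartDictionary

end Summit.ResolutionOfSingularities.ResolutionOfSingularities.Theorems.PIDim4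

end
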